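import Literature.AlgebraicGeometry.Resolution.HasseSchmidtDerivatives
import Mathlib.RingTheory.MvPolynomial.Homogeneous
import Mathlib.Algebra.MvPolynomial.Supported
import Mathlib.RingTheory.MvPolynomial.Basic
import HarnessLib

/-!
# Hasse–Schmidt derivatives of polynomials, II: coefficients, supports, `x_i`-expansions;
# graded and differentially stable subalgebras

Topic: `Literature/AlgebraicGeometry/Resolution`. Elementary calculus of the Hasse–Schmidt
derivations `D^{(β)} = hasseDeriv R β` of `R[x_j : j ∈ σ]` (`HasseSchmidtDerivatives.lean`:
`D^{(β)} f` is the coefficient of `u^β` in `f(x + u)`; `D^{(β)}(x^α) = (α choose β) x^{α-β}`), as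
needed for the structure theorem for graded, differentially stable subalgebras
(`DiffStableSubalgebra.lean`: Hironaka 1970, Giraud 1975 Lemme 1.6, Kawanoue 2007 Lemma 3.1.2.1)
behind Hironaka's additive group schemes / the ridge (`Ridge.lean`, "What is NOT here") and the
edge algebras of Hironaka's 2017 characteristic-`p` manuscript (`Literature/AlgebraicGeometry/
Hironaka2017/EdgeHilbert.lean`: manuscript p. 19 (8), p. 21 (25)).

## Contents (everything proved)

* `hasseDeriv_C`, `hasseDeriv_X`; **`hasseDeriv_mem_supported`** (`D^{(β)}` creates no variables)
  and **`hasseDeriv_eq_zero_of_mem_supported`** (`D^{(β)} f = 0` as soon as `β` involves a variable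
  that `f` does not);
* **`coeff_hasseDeriv_single`** — the one-directional binomial formula
  `coeff γ (D^{(k e_i)} f) = (γ_i + k choose k) · coeff (γ + k e_i) f`, and
  `isHomogeneous_hasseDeriv_single` (`D^{(k e_i)}` lowers the degree of a form by `k`);
* **`coeffX i k f`** — the coefficient of `x_i^k` in `f` regarded as a polynomial in `x_i` over
  `R[x_j : j ≠ i]`, for an ARBITRARY index `i : σ` (Mathlib's `optionEquivLeft` / `finSuccEquiv`
  single out a structural variable only): `coeff_coeffX`, `notMem_vars_coeffX`,
  `coeffX_mem_supported`; **`hasseDeriv_single_eq_coeffX`**: if `deg_{x_i} f ≤ t` then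
  `D^{(t e_i)} f = coeffX i t f` (the top `x_i`-coefficient is a Hasse–Schmidt derivative of `f`);
  `coeff_sub_X_pow_mul_coeffX` (removing the top `x_i`-layer);
* **`IsGradedSubalgebra U`** (`U` contains the homogeneous components of its elements) and
  **`IsDiffStable U`** (`U` is stable under every `D^{(β)}`; Kawanoue's "𝔇-saturated",
  Definition 3.1.1.1) for a subalgebra `U ⊆ R[x]`, with `IsGradedSubalgebra.inf_supported`,
  `IsDiffStable.inf_supported` (intersecting with a coordinate subring `R[x_j : j ∈ s]`,
  Mathlib's `MvPolynomial.supported`, preserves both).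

Design: everything is stated for an arbitrary index type `σ` (with `DecidableEq σ`; `Fintype σ`
where sums over all variables occur) and a commutative ring `R`; no scheme theory. The transport
of both predicates under linear substitutions is in `HasseSchmidtLinearSubstitution.lean` /
`DiffStableSubalgebra.lean`.

## References

* H. Kawanoue, *Toward resolution of singularities over a field of positive characteristic.
  Part I*, Publ. RIMS 43 (2007) 819–909 (arXiv:math/0607009), Ch. 1 (differential operators),
  Def. 3.1.1.1, Lemma 3.1.2.1. [Kawanoue2007]
* H. Hironaka, *Additive groups associated with points of a projective space*, Ann. of Math. 92
  (1970) 327–334. [Hironaka1970AdditiveGroups]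
-/

open MvPolynomial

namespace Literature.AlgebraicGeometry.Resolution

section HasseCalculus

variable {σ : Type*} (R : Type*) [CommRing R] [DecidableEq σ]

/-- `D^{(β)}` of a constant: `D^{(0)} c = c`, `D^{(β)} c = 0` for `β ≠ 0`. [folklore] -/
theorem hasseDeriv_C (β : σ →₀ ℕ) (c : R) :
    hasseDeriv R β (C c : MvPolynomial σ R) = if β = 0 then C c else 0 := by
  rw [hasseDeriv_apply, taylor_C, coeff_C]
  by_cases h : β = 0
  · subst h; simp
  · rw [if_neg (fun h' => h h'.symm), if_neg h]

/-- `D^{(β)}` of a variable: `D^{(0)} x_j = x_j`, `D^{(e_j)} x_j = 1`, all others vanish. [folklore] -/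
theorem hasseDeriv_X (β : σ →₀ ℕ) (j : σ) :
    hasseDeriv R β (X j : MvPolynomial σ R) =
      (if β = 0 then X j else 0) + (if β = Finsupp.single j 1 then 1 else 0) := by
  rw [hasseDeriv_apply, taylor_X, coeff_add, coeff_C, coeff_X]
  congr 1
  · by_cases h : β = 0
    · subst h; simp
    · rw [if_neg (fun h' => h h'.symm), if_neg h]
  · by_cases h : β = Finsupp.single j 1
    · subst h; simp
    · rw [if_neg (fun h' => h h'.symm), if_neg h]

/-- **Hasse–Schmidt derivatives do not create variables**: if `f` only involves the variables of
`s`, so does every `D^{(β)} f`. [folklore] -/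
theorem hasseDeriv_mem_supported {s : Set σ} {f : MvPolynomial σ R}
    (hf : f ∈ supported R s) (β : σ →₀ ℕ) : hasseDeriv R β f ∈ supported R s := by
  rw [supported_eq_adjoin_X] at hf ⊢
  induction hf using Algebra.adjoin_induction generalizing β with
  | mem x hx =>
    obtain ⟨j, hj, rfl⟩ := hx
    rw [hasseDeriv_X]
    refine add_mem ?_ ?_
    · split_ifs
      · exact Algebra.subset_adjoin ⟨j, hj, rfl⟩
      · exact zero_mem _
    · split_ifs
      · exact one_mem _
      · exact zero_mem _
  | algebraMap r =>
    rw [MvPolynomial.algebraMap_eq, hasseDeriv_C]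
    split_ifs
    · exact Subalgebra.algebraMap_mem _ r
    · exact zero_mem _
  | add x y _ _ ihx ihy => rw [map_add]; exact add_mem (ihx β) (ihy β)
  | mul x y _ _ ihx ihy =>
    rw [hasseDeriv_mul]
    exact Subalgebra.sum_mem _ fun q _ => mul_mem (ihx q.1) (ihy q.2)

/-- **`D^{(β)} f = 0` if `β` involves a variable `x_i` that `f` does not.** [folklore] -/
theorem hasseDeriv_eq_zero_of_mem_supported {s : Set σ} {f : MvPolynomial σ R}
    (hf : f ∈ supported R s) {i : σ} (hi : i ∉ s) :
    ∀ {β : σ →₀ ℕ}, β i ≠ 0 → hasseDeriv R β f = 0 := by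
  rw [supported_eq_adjoin_X] at hf
  induction hf using Algebra.adjoin_induction with
  | mem x hx =>
    intro β hβ
    obtain ⟨j, hj, rfl⟩ := hx
    have hji : j ≠ i := fun h => hi (h ▸ hj)
    rw [hasseDeriv_X, if_neg, if_neg, add_zero]
    · intro h; apply hβ; rw [h, Finsupp.single_apply, if_neg hji]
    · intro h; apply hβ; rw [h]; rfl
  | algebraMap r =>
    intro β hβ
    rw [MvPolynomial.algebraMap_eq, hasseDeriv_C, if_neg]
    intro h; apply hβ; rw [h]; rfl
  | add x y _ _ ihx ihy => intro β hβ; rw [map_add, ihx hβ, ihy hβ, add_zero]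
  | mul x y _ _ ihx ihy =>
    intro β hβ
    rw [hasseDeriv_mul]
    refine Finset.sum_eq_zero fun q hq => ?_
    rw [Finset.mem_antidiagonal] at hq
    have : q.1 i ≠ 0 ∨ q.2 i ≠ 0 := by
      by_contra h
      push Not at h
      apply hβ
      rw [← hq, Finsupp.add_apply, h.1, h.2]
    rcases this with h | h
    · rw [ihx h, zero_mul]
    · rw [ihy h, mul_zero]

omit [DecidableEq σ] in
/-- A monomial not involving `x_i` lies in `R[x_j : j ≠ i]`. [folklore] -/
theorem monomial_erase_mem_supported (α : σ →₀ ℕ) (i : σ) (c : R) :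
    monomial (α.erase i) c ∈ supported R {j : σ | j ≠ i} := by
  rw [mem_supported]
  intro j hj
  simp only [Finset.mem_coe, mem_vars_iff_mem_support] at hj
  obtain ⟨d, hd, hjd⟩ := hj
  classical
  rw [support_monomial] at hd
  split_ifs at hd with hc
  · exact absurd hd (Finset.notMem_empty _)
  · rw [Finset.mem_singleton] at hd
    subst hd
    intro h
    subst h
    rw [Finsupp.mem_support_iff, Finsupp.erase_same] at hjd
    exact hjd rfl

/-- **Coefficients of a Hasse–Schmidt derivative in one direction**:
`coeff_γ (D^{(k e_i)} f) = (γ_i + k choose k) · coeff_{γ + k e_i} f` — the multivariate form of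
`Polynomial.hasseDeriv_coeff`. [folklore] -/
theorem coeff_hasseDeriv_single (i : σ) (k : ℕ) (f : MvPolynomial σ R)
    (γ : σ →₀ ℕ) :
    coeff γ (hasseDeriv R (Finsupp.single i k) f) =
      ((γ i + k).choose k : R) * coeff (γ + Finsupp.single i k) f := by
  induction f using MvPolynomial.induction_on' generalizing γ with
  | add f g hf hg => rw [map_add, coeff_add, coeff_add, hf, hg, mul_add]
  | monomial α c =>
    -- `x^α = x^{α - α_i e_i} · x_i^{α_i}` and the Leibniz rule: only the term where all of
    -- `D^{(k e_i)}` falls on `x_i^{α_i}` survives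
    have hsplit : (monomial α c : MvPolynomial σ R) =
        monomial (α.erase i) c * X i ^ (α i) := by
      rw [X_pow_eq_monomial, monomial_mul, mul_one, Finsupp.erase_add_single]
    have hvan : ∀ q ∈ Finset.antidiagonal (Finsupp.single i k),
        q ≠ (0, Finsupp.single i k) →
        hasseDeriv R q.1 (monomial (α.erase i) c) * hasseDeriv R q.2 (X i ^ α i) = 0 := by
      intro q hq hne
      rw [Finset.mem_antidiagonal] at hq
      have hq1 : q.1 i ≠ 0 := by
        intro h0
        apply hne
        have h1 : q.1 = 0 := by
          ext j
          by_cases hj : j = i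
          · rw [hj, h0]; rfl
          · have := DFunLike.congr_fun hq j
            rw [Finsupp.add_apply, Finsupp.single_apply, if_neg (Ne.symm hj)] at this
            simp only [Finsupp.coe_zero, Pi.zero_apply]
            omega
        rw [h1, zero_add] at hq
        exact Prod.ext h1 hq
      rw [hasseDeriv_eq_zero_of_mem_supported R (monomial_erase_mem_supported R α i c)
        (i := i) (by simp) hq1, zero_mul]
    rw [coeff_monomial, hsplit, hasseDeriv_mul, Finset.sum_eq_single (0, Finsupp.single i k) hvan
      (fun h => absurd (by simp) h), hasseDeriv_zero_apply, hasseDeriv_X_pow]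
    -- now a computation with monomials
    have hmono : monomial (α.erase i) c * (((α i).choose k : MvPolynomial σ R) * X i ^ (α i - k)) =
        monomial (α.erase i + Finsupp.single i (α i - k)) (c * (α i).choose k) := by
      rw [← map_natCast (C : R →+* MvPolynomial σ R), X_pow_eq_monomial, C_mul_monomial, mul_one,
        monomial_mul]
    rw [hmono, coeff_monomial]
    by_cases h : α = γ + Finsupp.single i k
    · -- the surviving coefficient
      have hαi : α i = γ i + k := by rw [h]; simp
      have hm : α.erase i + Finsupp.single i (α i - k) = γ := by
        rw [h]
        ext j
        by_cases hj : j = i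
        · subst hj; simp
        · simp [hj]
      rw [if_pos hm, if_pos h, hαi, mul_comm]
    · rw [if_neg h, mul_zero]
      split_ifs with hm
      · -- then `k > α i`, so the binomial coefficient vanishes
        have hk : α i < k := by
          by_contra hle
          push Not at hle
          apply h
          rw [← hm]
          ext j
          by_cases hj : j = i
          · subst hj; simp; omega
          · simp [hj]
        rw [Nat.choose_eq_zero_of_lt hk, Nat.cast_zero, mul_zero]
      · rfl

/-- A Hasse–Schmidt derivative in one direction lowers the degree of a form:
`D^{(k e_i)}` maps forms of degree `d` to forms of degree `d - k`. [folklore] -/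
theorem isHomogeneous_hasseDeriv_single {f : MvPolynomial σ R} {d : ℕ}
    (hf : f.IsHomogeneous d) (i : σ) (k : ℕ) :
    (hasseDeriv R (Finsupp.single i k) f).IsHomogeneous (d - k) := by
  intro γ hγ
  rw [coeff_hasseDeriv_single] at hγ
  have h2 : coeff (γ + Finsupp.single i k) f ≠ 0 := fun h => hγ (by rw [h, mul_zero])
  have := hf h2
  rw [map_add] at this
  have hk : Finsupp.weight (1 : σ → ℕ) (Finsupp.single i k) = k := by
    rw [Finsupp.weight_single, Pi.one_apply, smul_eq_mul, mul_one]
  rw [hk] at this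
  omega

end HasseCalculus

section CoeffX

/-! ### The coefficients of the powers of one variable -/

variable {σ : Type*} [DecidableEq σ] (R : Type*) [CommRing R]

/-- **The coefficient of `x_i^k`** in `f`, viewed as a polynomial in `x_i` with coefficients
polynomials in the other variables (Mathlib's `optionEquivLeft`/`finSuccEquiv` do this only for a
distinguished variable of `Option σ`/`Fin (n+1)`; here `i : σ` is arbitrary). [folklore] -/
noncomputable def coeffX (i : σ) (k : ℕ) (f : MvPolynomial σ R) : MvPolynomial σ R :=
  ∑ α ∈ f.support with α i = k, monomial (α.erase i) (coeff α f)

/-- The coefficients of `coeffX i k f`: `coeff γ = coeff (γ + k e_i) f` for `γ_i = 0`, else `0`. [folklore] -/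
theorem coeff_coeffX (i : σ) (k : ℕ) (f : MvPolynomial σ R) (γ : σ →₀ ℕ) :
    coeff γ (coeffX R i k f) = if γ i = 0 then coeff (γ + Finsupp.single i k) f else 0 := by
  rw [coeffX, coeff_sum]
  simp_rw [coeff_monomial]
  split_ifs with hγ
  · have hγe : (γ + Finsupp.single i k).erase i = γ := by
      ext j
      by_cases hj : j = i
      · subst hj; rw [Finsupp.erase_same, hγ]
      · rw [Finsupp.erase_ne hj]
        simp [Ne.symm hj]
    rw [Finset.sum_eq_single (γ + Finsupp.single i k)]
    · rw [if_pos hγe]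
    · intro α hα hne
      rw [Finset.mem_filter] at hα
      rw [if_neg]
      intro h
      apply hne
      rw [← Finsupp.erase_add_single i α, h, hα.2]
    · intro h
      rw [if_pos hγe]
      rw [Finset.mem_filter, not_and] at h
      by_contra hc
      exact h (mem_support_iff.mpr hc) (by simp [hγ])
  · refine Finset.sum_eq_zero fun α _ => ?_
    rw [if_neg]
    intro h
    apply hγ
    rw [← h, Finsupp.erase_same]

/-- `coeffX i k f` does not involve `x_i`. [folklore] -/
theorem notMem_vars_coeffX (i : σ) (k : ℕ) (f : MvPolynomial σ R) : i ∉ (coeffX R i k f).vars := by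
  intro h
  rw [mem_vars_iff_mem_support] at h
  obtain ⟨d, hd, hid⟩ := h
  rw [mem_support_iff, coeff_coeffX] at hd
  split_ifs at hd with h0
  · rw [Finsupp.mem_support_iff] at hid; exact hid h0
  · exact hd rfl

/-- The variables of `coeffX i k f` are among those of `f`, minus `x_i`. [folklore] -/
theorem coeffX_mem_supported (i : σ) (k : ℕ) {S : Set σ} {f : MvPolynomial σ R}
    (hf : f ∈ supported R S) : coeffX R i k f ∈ supported R (S \ {i}) := by
  rw [mem_supported] at hf ⊢
  intro j hj
  rw [Finset.mem_coe, mem_vars_iff_mem_support] at hj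
  obtain ⟨d, hd, hjd⟩ := hj
  rw [mem_support_iff, coeff_coeffX] at hd
  split_ifs at hd with h0
  · have hji : j ≠ i := by
      intro h; subst h; rw [Finsupp.mem_support_iff] at hjd; exact hjd h0
    refine ⟨hf ?_, hji⟩
    rw [Finset.mem_coe, mem_vars_iff_mem_support]
    refine ⟨d + Finsupp.single i k, mem_support_iff.mpr hd, ?_⟩
    rw [Finsupp.mem_support_iff] at hjd ⊢
    rw [Finsupp.add_apply, Finsupp.single_apply, if_neg (Ne.symm hji), add_zero]
    exact hjd
  · exact absurd rfl hd

/-- **The top coefficient in `x_i` is a Hasse–Schmidt derivative**: if `deg_{x_i} f ≤ t` then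
`coeffX i t f = D^{(t e_i)} f`. [folklore] -/
theorem hasseDeriv_single_eq_coeffX (i : σ) (t : ℕ) {f : MvPolynomial σ R}
    (ht : ∀ α ∈ f.support, α i ≤ t) : hasseDeriv R (Finsupp.single i t) f = coeffX R i t f := by
  ext γ
  rw [coeff_hasseDeriv_single, coeff_coeffX]
  split_ifs with h0
  · rw [h0, zero_add, Nat.choose_self, Nat.cast_one, one_mul]
  · rw [notMem_support_iff.mp, mul_zero]
    intro hmem
    have := ht _ hmem
    rw [Finsupp.add_apply, Finsupp.single_eq_same] at this
    omega

/-- Removing the top `x_i`-layer: the coefficients of `f - x_i^t · coeffX i t f`. [folklore] -/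
theorem coeff_sub_X_pow_mul_coeffX (i : σ) (t : ℕ) (f : MvPolynomial σ R) (α : σ →₀ ℕ) :
    coeff α (f - X i ^ t * coeffX R i t f) = if α i = t then 0 else coeff α f := by
  rw [coeff_sub, X_pow_eq_monomial, coeff_monomial_mul', one_mul, coeff_coeffX]
  by_cases hle' : Finsupp.single i t ≤ α
  · rw [if_pos hle']
    have hle : t ≤ α i := Finsupp.single_le_iff.mp hle'
    have hsub : (α - Finsupp.single i t) i = α i - t := by
      rw [Finsupp.tsub_apply, Finsupp.single_eq_same]
    rw [hsub]
    by_cases heq : α i = t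
    · rw [if_pos (by omega), if_pos heq, tsub_add_cancel_of_le hle', sub_self]
    · rw [if_neg (by omega), if_neg heq, sub_zero]
  · rw [if_neg hle']
    have : ¬ t ≤ α i := fun h => hle' (Finsupp.single_le_iff.mpr h)
    rw [if_neg (by omega), sub_zero]

end CoeffX

section DiffStableDefs

/-! ### Graded, differentially stable subalgebras -/

variable {σ : Type*} [Fintype σ] [DecidableEq σ] {R : Type*} [CommRing R]

/-- `U ⊆ R[x]` is a **graded** (homogeneous) subalgebra: it contains the homogeneous components of
its elements. [folklore] -/
def IsGradedSubalgebra (U : Subalgebra R (MvPolynomial σ R)) : Prop :=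
  ∀ f ∈ U, ∀ d : ℕ, homogeneousComponent d f ∈ U

/-- `U ⊆ R[x]` is **differentially stable** (`Diff`-stable, `𝔇`-saturated): it is stable under
all Hasse–Schmidt derivations `D^{(β)}`. [cite: Kawanoue2007, Definition 3.1.1.1 and Lemma 3.1.2.1 (𝔇-saturated)] -/
def IsDiffStable (U : Subalgebra R (MvPolynomial σ R)) : Prop :=
  ∀ f ∈ U, ∀ β : σ →₀ ℕ, hasseDeriv R β f ∈ U

omit [Fintype σ] [DecidableEq σ] in
/-- The exponents occurring in a form of degree `n` have degree `n`. [folklore] -/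
theorem degree_eq_of_mem_support {φ : MvPolynomial σ R} {n : ℕ} (hφ : φ.IsHomogeneous n)
    {d : σ →₀ ℕ} (hd : d ∈ φ.support) : d.degree = n := by
  by_contra h
  exact (mem_support_iff.mp hd) (hφ.coeff_eq_zero h)

omit [Fintype σ] [DecidableEq σ] in
/-- Homogeneous components do not create variables. [folklore] -/
theorem homogeneousComponent_mem_supported {s : Set σ} {f : MvPolynomial σ R}
    (hf : f ∈ supported R s) (d : ℕ) : homogeneousComponent d f ∈ supported R s := by
  rw [mem_supported] at hf ⊢
  intro j hj
  rw [Finset.mem_coe, mem_vars_iff_mem_support] at hj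
  obtain ⟨α, hα, hjα⟩ := hj
  rw [mem_support_iff, coeff_homogeneousComponent] at hα
  split_ifs at hα with h
  · exact hf (by rw [Finset.mem_coe, mem_vars_iff_mem_support]; exact ⟨α, mem_support_iff.mpr hα, hjα⟩)
  · exact absurd rfl hα

omit [Fintype σ] [DecidableEq σ] in
/-- Intersecting with a coordinate subring `R[x_j : j ∈ s]` preserves gradedness. [folklore] -/
theorem IsGradedSubalgebra.inf_supported {U : Subalgebra R (MvPolynomial σ R)}
    (hU : IsGradedSubalgebra U) (s : Set σ) : IsGradedSubalgebra (U ⊓ supported R s) := by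
  intro f hf d
  rw [Algebra.mem_inf] at hf ⊢
  exact ⟨hU f hf.1 d, homogeneousComponent_mem_supported hf.2 d⟩

omit [Fintype σ] in
/-- Intersecting with a coordinate subring `R[x_j : j ∈ s]` preserves differential stability. [folklore] -/
theorem IsDiffStable.inf_supported {U : Subalgebra R (MvPolynomial σ R)}
    (hU : IsDiffStable U) (s : Set σ) : IsDiffStable (U ⊓ supported R s) := by
  intro f hf β
  rw [Algebra.mem_inf] at hf ⊢
  exact ⟨hU f hf.1 β, hasseDeriv_mem_supported R hf.2 β⟩

end DiffStableDefs

end Literature.AlgebraicGeometry.Resolution
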